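import Literature.MathematicalPhysics.QuantumFieldTheory.Balaban1983to89.B9Cor36CinvAtCubeAssembly

/-!
# `Balaban1983to89.B9Cor36CinvCoverBinders` — THE C-JUNCTION OF [B9] (3.95) OVER THE WHOLE CUBE COVER OF ONE MEMBER: FILE E2-5b-4's per-cube tuple
# `(C_□, E_□, hdef, hC, hEd)` packaged as the `∀ □` binders `Cl E : cubes → End`, `hdef ∕ hC ∕ hEd : ∀ □, …` of p21's M5.6 defect edition
# `B9Thm39CinvAtCoverLargeDefect.cinv_cover_large_defect` at per-cube (3.35) data `(u_□, A_□, Q_□, C_□, ξ_□, Λ_□)` and the member's rates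
# (sub-row G-B9-LETTERS, module M5.2-E, FILE E2-6; design (β) of `lit-balaban-p21/M52E-DESIGN-p21.md`)

T. Bałaban, *Propagators for lattice gauge theories in a background field*, Commun. Math. Phys. **99** (1985) 389–434
[`Balaban1985BackgroundPropagators`, "B9"]; [4] = T. Bałaban, *Propagators and renormalization transformations for lattice gauge
theories. II*, Commun. Math. Phys. **96** (1984) 223–250 [`Balaban1984PropagatorsII`].

statement-level skeleton of published theorems with citation tags; proofs where landed; nothing here is a claim about the
Yang–Mills mass gap

THE PRINTED LOCUS (verbatim, held `paper:balaban1985-cmp99-background-propagators`, journal page = PDF page + 388).  (3.95) p. 411 l. 5–10 (the three sums over the cubes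
`□` of the cover, *«Σ_□(1 − □̃)Q′G′²Q′\*h_□C_□h_□ + Σ_□ □̃Q′(G′² − G′²_□)Q′\*h_□C_□h_□ + Σ_□[□̃Q′G′²_□Q′\*, h_□]C_□h_□»*); p. 409 l. 1–5 (*«the sequence {Ω_n(□)} satisfies the
assumptions of Corollary 3.6 … C_□(U) = (Q′(U)G′²_□(U)Q′\*(U))⁻¹ … satisfy all the inequalities of Theorems 3.1–3.3»* — FOR EVERY cube of the cover); p. 408 l. 20–25 (*«for each
cube □ from 𝒟_j … there exists a gauge transformation u defined on □̃⁵»* — the datum is PER CUBE); Cor. 3.6 p. 408; Thm 3.2 (3.48) p. 398.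

WHY THIS FILE.  FILE E2-5b-4 (`B9Cor36CinvAtCubeAssembly.cinvLoc_tuple_at_datum`) delivers, for ONE cover cube and its (3.35) datum, M5.6's three per-cube binders.  The
consumer `cinv_cover_large_defect` takes them as FUNCTIONS on the cubes of the member (`Oc`, `Cl E : cubes → …`, `hdef ∕ hC ∕ hEd : ∀ c, …`) at ONE rate triple
`(bbδ₀, a_Xδ₀, a_Eδ₀)`, and print's datum is per cube (its own gauge `u_□` and potential `A_□` on `□̃⁵`).  THIS FILE is the quantifier bookkeeping: ★★★
`cinvLoc_cover_binders` — for the constants of E2-5b-4 and every member above the thresholds (print's units `c_f = L^k`), every section `ιB`, field `U`, rates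
`0 ≦ b_C, a_E ≦ δ` and every FAMILY of per-cube data `(u, A, Q, C, ξ, Λ) : cubes → …` satisfying the datum hypotheses cube by cube, the three `∀ □` binders of M5.6 hold
for `Oc □ := fun _ => locLetterY i □ parSymY (u □) χ_□ Ṽ_□`, `Cl □ := (cinvLocLetterY i □ parSymY (u □) Ṽ_□ N_□)|_ℝ`, `E □ := (cinvLocDefectY i □ parSymY (u □) χ_□ Ṽ_□ N_□ h_□)|_ℝ`
(`Ṽ_□ = locCfgY i □ η (A □)`) — `hdef` verbatim, `hC` at `B₀·ℓ⁻⁴·e^{−b_C d}`, `hEd` at `κ_E·e^{−a_X·D_sep}·e^{−a_E d}` (M5.6: `bbδ₀ := b_C`, `a_Xδ₀ := a_X`, `a_Eδ₀ := a_E`).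

HONEST SCOPE / NOT CLAIMED.  Pure packaging of E2-5b-4 (no estimate added).  DISPLAYED as there: per-cube data in p33's `gp_cube_at_locCfg` form, bi-contractive gauges,
member thresholds, `c_f = L^k`, `[NormOneClass 𝔸]`, `[Fintype (geo9K i).Site]`.  NOT supplied: M5.6's `hE`, `hEc` (p33's M5.1b-G′), `hD` (cell GAPS G-B9-05), `IsUnit XY`,
`hpar`, and the final instantiation of `cinv_cover_large_defect` (the assembler's).  `E_□`, `N_□` are the (R)-design term of GAPS.md G-B9-p21-01 (print's `C_□` needs neither).
Count-neutral; no summit ∕ sub-problem statement is proved; nothing continuum ∕ OS ∕ mass-gap ∕ Clay; NOT a node discharge.  No `sorry`, no `axiom`, no `… : Prop` fact, no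
`instance`, no `notation`, no `def`.  NEW file; nothing landed is modified.  Cell `lit-balaban`, seat `lit-balaban-p21` gen 35, 2026-08-28; `--supports
stmt-QuantumFields-19200` as helper.  Net new unproved facts: 0.

RELATED IN THE TREE, NOT DUPLICATED (searched 2026-08-28: `lean search 'cover_binders' --decl` = ∅): E2-5b-4 `B9Cor36CinvAtCubeAssembly` (USED), E1-4
`B9Thm39CinvAtCoverLargeDefect` (the consumer; its binder shapes copied, not imported), p33 `B9Cor36GpCubeExtAtV` — no existing module modified.
-/

noncomputable section

namespace Literature.MathematicalPhysics.QuantumFieldTheory.Balaban1983to89.B9Cor36CinvCoverBinders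

open B4PartitionUnity22 (thetaProf D1)
open B6RandomWalk (HasMajorant)
open B9Thm34Ext (toB6)
open B9Eq352DivFormLetters (conj)
open B9Eq39Adjoint (fluct covD)
open B6KLevelCensusIndexV1 (KIdx kGeo)
open B6Cover236MultiLevelBlocks (cubes)
open B6Cover236MultiLevelTorusBlocks (hB)
open B6GlobalChartV1 (PV boxEquiv)
open B6Ineq2142KLevelV1 (β)
open B9BackgroundsKLevelV1 (shiftsV1)
open B9Eq360DeltaPrimeAY (AfldY)
open B9CubeGeometryInputs (RM1)
open B9GeoNormsKLevelV1 (geo9K)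
open B9Cor36CubeCutoffs (SC NearC chiY locCfgY)
open B9Cor36GpCubeLocLetter (locLetterY)
open B9Cor36CinvCubeLocLetter (cinvLocLetterY cinvLocDefectY)
open B9Cor36CubeTwinsGeometry (nearN)
open B9Cor36CinvAtCubeAssembly (cinvLoc_tuple_at_datum)
open B9Thm37CubeCoverCommutators (cutMulY)
open B9Thm39CinvAtCover (chiBigT DsepT)
open Node00 (SiteY BlkY CfgY GaugeY IBondY toKT gaugeY parSymY XY etaS)

variable {d ℓ : ℕ} {hd : 1 ≤ d + 1} {hL : Odd (ℓ + 1) ∧ 1 < ℓ + 1} {b₀ b₁ : ℝ}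
variable {𝔸 : Type} [NormedRing 𝔸] [NormedAlgebra ℂ 𝔸] [CompleteSpace 𝔸] [NormOneClass 𝔸]
variable {ι : Type} [Fintype ι] [DecidableEq ι] (b : Module.Basis ι ℝ 𝔸)
variable [∀ i' : KIdx d ℓ hd hL b₀ b₁, Fintype (geo9K i').Site]

/-- ★★★ **M5.6's `∀ □` BINDERS `hdef`, `hC`, `hEd` FOR THE C-JUNCTION LETTERS OF RECORD, FROM PER-CUBE (3.35) DATA** (FILE E2-5b-4 cube by cube; quantifier bookkeeping
only): for E2-5b-4's constants `(M₀, T₀, N₀, a₁, δ, a_X, B₀, κ_E)` and every member above the thresholds with `c_f = L^k`, every section `ιB`, field `U`, rates `0 ≦ b_C, a_E ≦ δ`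
and every family of per-cube data — a bi-contractive gauge `u_□`, a potential `A_□` on a torus set `Q_□ ⊇ NearC_□(35S_j/8 + 1)` with `U^{u_□} = e^{iηA_□}` on its bonds,
`‖A_□‖ ≦ C_□ξ_□⁻¹`, `‖η⁻¹∂A_□‖ ≦ C_□ξ_□⁻²`, `0 < ξ_□ ≦ 5S_jη`, `L^{j+1}η ≦ Λ_□ξ_□`, `1 ≦ Λ_□`, `max C_□ (C_□(1+D₁θ))Λ_□² ≦ min(a₁, 1/4)` — the binders hold for all cubes at once.
[cite: Balaban1985BackgroundPropagators, (3.95) p.411, p.409 l.1–5, p.408 l.20–25, Cor. 3.6 p.408, Thm 3.2 (3.48) p.398; Balaban1984PropagatorsII, (2.79)–(2.85) pp.237–238] -/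
theorem cinvLoc_cover_binders (hℓ : 1 ≤ ℓ) {M₂ : ℝ} (hM₂ : 0 ≤ M₂) (hrepr : ∀ (v : 𝔸) (j : ι), |b.repr v j| ≤ M₂ * ‖v‖) :
    ∃ M₀ T₀ : ℝ, ∃ N₀ : ℕ, ∃ a₁ : ℝ, 0 < a₁ ∧ ∃ δ aX B₀ κE : ℝ, 0 < δ ∧ 0 < aX ∧ 0 ≤ B₀ ∧ 0 ≤ κE ∧
    ∀ (i : KIdx d ℓ hd hL b₀ b₁) (Rr : ℝ) (Hp : Prop),
      M₀ ≤ ((ℓ : ℝ) + 1) * (toKT i).Mh → N₀ + 1 ≤ (toKT i).R * ((ℓ + 1) * (toKT i).Mh) → T₀ ≤ RM1 i → i.cf = (((ℓ + 1 : ℕ) : ℝ)) ^ i.k →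
    ∀ (ιB : BlkY i → IBondY i), (∀ s, β i.hN i.D i.hk (ιB s) = s) →
    ∀ (U : CfgY 𝔸 i) (g : ↥(cubes (toKT i).D.toDomains) → GaugeY 𝔸 i),
      (∀ c x, ‖(g c x : 𝔸)‖ ≤ 1 ∧ ‖(((g c x)⁻¹ : 𝔸ˣ) : 𝔸)‖ ≤ 1) →
    ∀ (A : ↥(cubes (toKT i).D.toDomains) → AfldY 𝔸 i) (Q : ↥(cubes (toKT i).D.toDomains) → Set (Site (PV d ℓ i.m i.K hd hL) 0))
      (C ξ Λ : ↥(cubes (toKT i).D.toDomains) → ℝ),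
      (∀ c, 0 ≤ C c) → (∀ c, 0 < ξ c) → (∀ c, 1 ≤ Λ c) → (∀ c, ξ c ≤ 5 * (SC i c : ℝ) * (kGeo i).eta) →
      (∀ c, LatticeNorms.scaleLen ((ℓ : ℝ) + 1) (kGeo i).eta (c.1.1 + 1) ≤ Λ c * ξ c) →
      (∀ c, ∀ x : Site (PV d ℓ i.m i.K hd hL) 0, NearC i c (35 * SC i c / 8 + 1) (boxEquiv i.hN x).1 → x ∈ Q c) →
      (∀ c, ∀ (κ : Fin (d + 1)) (x : Site (PV d ℓ i.m i.K hd hL) 0), x ∈ Q c → x.shift κ ∈ Q c → gaugeY i (g c) U κ x = fluct (kGeo i).eta (A c) κ x) →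
      (∀ c, ∀ κ, ∀ x ∈ Q c, ‖A c κ x‖ ≤ C c * (ξ c)⁻¹) →
      (∀ c, ∀ μ ν, ∀ x ∈ Q c, ‖(((kGeo i).eta : ℂ)⁻¹) • covD (shiftsV1 (PV d ℓ i.m i.K hd hL)) (fun _ _ => (1 : 𝔸ˣ)) μ (A c ν) x‖ ≤ C c * (ξ c ^ 2)⁻¹) →
      (∀ c, max (C c) (C c * (1 + D1 thetaProf)) * Λ c ^ 2 ≤ a₁) → (∀ c, max (C c) (C c * (1 + D1 thetaProf)) * Λ c ^ 2 ≤ 1 / 4) →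
    ∀ (bC aE : ℝ), 0 ≤ bC → bC ≤ δ → 0 ≤ aE → aE ≤ δ →
      (∀ c : ↥(cubes (toKT i).D.toDomains),
        (cutMulY (𝔸 := 𝔸) (hB i.D c)).restrictScalars ℝ *
            ((cutMulY (𝔸 := 𝔸) (chiBigT i c)).restrictScalars ℝ *
              (XY i (parSymY i) (fun _ => locLetterY i c (parSymY i) (g c) (chiY i c) (locCfgY i c (kGeo i).eta (A c))) U).restrictScalars ℝ) *
            (cinvLocLetterY i c (parSymY i) (g c) (locCfgY i c (kGeo i).eta (A c)) (nearN i c)).restrictScalars ℝ *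
            (cutMulY (𝔸 := 𝔸) (hB i.D c)).restrictScalars ℝ =
          (cutMulY (𝔸 := 𝔸) (hB i.D c)).restrictScalars ℝ * (cutMulY (𝔸 := 𝔸) (hB i.D c)).restrictScalars ℝ +
            (cinvLocDefectY i c (parSymY i) (g c) (chiY i c) (locCfgY i c (kGeo i).eta (A c)) (nearN i c) (hB i.D c)).restrictScalars ℝ) ∧
      (∀ c : ↥(cubes (toKT i).D.toDomains),
        HasMajorant (g := toB6 (geo9K i) Rr Hp) (fun p : BlkY i × ι => ιB p.1)
          (conj b ((etaS i ^ 2 * etaS i ^ 2)⁻¹ •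
            (cinvLocLetterY i c (parSymY i) (g c) (locCfgY i c (kGeo i).eta (A c)) (nearN i c)).restrictScalars ℝ))
          (fun a a' => B₀ * ((geo9K i).len a ^ 4)⁻¹ * Real.exp (-(bC * (geo9K i).dist a a')))) ∧
      (∀ c : ↥(cubes (toKT i).D.toDomains),
        HasMajorant (g := toB6 (geo9K i) Rr Hp) (fun p : BlkY i × ι => ιB p.1)
          (conj b ((cinvLocDefectY i c (parSymY i) (g c) (chiY i c) (locCfgY i c (kGeo i).eta (A c)) (nearN i c) (hB i.D c)).restrictScalars ℝ))
          (fun a a' => κE * Real.exp (-(aX * DsepT i)) * Real.exp (-(aE * (geo9K i).dist a a')))) := by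
  obtain ⟨M₀, T₀, N₀, a₁, ha₁, δ, aX, B₀, κE, hδ, haX, hB₀, hκE, H⟩ := cinvLoc_tuple_at_datum b (hd := hd) (hL := hL) (b₀ := b₀) (b₁ := b₁) hℓ hM₂ hrepr
  refine ⟨M₀, T₀, N₀, a₁, ha₁, δ, aX, B₀, κE, hδ, haX, hB₀, hκE, ?_⟩
  intro i Rr Hp hM hN hT hcfk ιB hι U g hu A Q C ξ Λ hC0 hξ hΛ hξS hΛξ hQ hgA hA hdA hα₁ hα4 bC aE hbC0 hbC haE0 haE
  have key := fun c : ↥(cubes (toKT i).D.toDomains) =>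
    H i c Rr Hp hM hN hT hcfk ιB hι (g c) (hu c) U (A c) (Q c) (C c) (ξ c) (Λ c) (hC0 c) (hξ c) (hΛ c) (hξS c) (hΛξ c) (hQ c) (hgA c) (hA c) (hdA c)
      (hα₁ c) (hα4 c)
  exact ⟨fun c => (key c).1, fun c => (key c).2.1 bC hbC0 hbC, fun c => (key c).2.2 aE haE0 haE⟩

end Literature.MathematicalPhysics.QuantumFieldTheory.Balaban1983to89.B9Cor36CinvCoverBinders

end
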